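import Summits.BirchSwinnertonDyer.BirchSwinnertonDyer.Theses.UniversalToricDescent
import Summits.BirchSwinnertonDyer.BirchSwinnertonDyer.Theorems.UniversalToricDescentRoadFFCpIntMemberTower
import Summits.BirchSwinnertonDyer.BirchSwinnertonDyer.Theorems.UniversalToricDescentSelfMuZeroAtThree
import Summits.BirchSwinnertonDyer.BirchSwinnertonDyer.Theorems.UniversalToricDescentTwinDecLocusCubeTest
import Literature.NumberTheory.EllipticCurves.Skinner2016.HidaCongruentMembers
import Literature.NumberTheory.EllipticCurves.NonEisensteinPrimeOfSurjective
import Literature.NumberTheory.EllipticCurves.Castella2018.HidaMembersFramesSigmaCongruenceOddPrime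
import Literature.NumberTheory.EllipticCurves.HeegnerPointsProofs
import Literature.NumberTheory.EllipticCurves.PastenValuationProductThm75ExplicitProofs
import HarnessLib

/-!
# Route `UniversalToricDescent`, ♭B′ `TwinWanFrameAtThreeMultTresT` (stmt-BirchSwinnertonDyer-27401) BY NAME from Hsieh 2014 Thm B,
# the CONSUMER-MINIMAL reading of Castella 2020 §2 / Skinner 2016 §2.6 at an odd prime OVER AN ALL-SPLIT `K`, and K1-at-3 —
# the consumer-side repair of the line `membertower` v11 after the vet RETURN of its published-input stub
# `TwinCastellaMembersFramesCongruenceOddInput` (stmt-BirchSwinnertonDyer-27933; refuter bsd-vet-utdR2 g0, 2026-08-28)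

`--supports stmt-BirchSwinnertonDyer-27401 --as helper` (width seat bsd-wall-utd-p2-w2 g7). WHY THIS FILE EXISTS. The landed glue
of line `membertower` v11 (`UniversalToricDescentTwinWanFrameAtThreeMultTresT.twinWanFrameAtThreeMultTresT_of_thmB_of_castella2020odd_of_rationalInclusion`,
p635340, lead utd-p2 g13) takes as its second hypothesis the Literature `Prop`
`Castella2018.castella2020_thm211_members_frames_sigma_congruence_odd` (p633915). The vet (VET-UTDR2-g0.md, evidence on 27933/27934)
RETURNED that `Prop` as MISSTATED: its conclusion carries the rigidity-SIGN conjunct «`a_ℓ(g_m) = −ℓ^{k_m/2−1}` at every `ℓ ∣ N/p`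
non-split in `K`» while its binders omit print's hypothesis (iii) of Castella's erratum / arXiv:2409.01360 Thm. 1.3 («`E` has NON-SPLIT
multiplicative reduction at each `q ∥ N` non-split in `K`»); at a ramified `ℓ ∥ N` with `a_ℓ(E) = +1` the conjunct fails for every
member (witness `39a1`, `K = ℚ(√−143)`, `p = 3`). The UTD consumer instantiates the fact ONLY at an all-split `K`
(`SatisfiesHeegnerHypothesis N′ K`), where that conjunct is vacuous, and the glue p635340 USES only three clauses of the member data
(`ι′`-compatibility, the Σ-imprimitive weight-`k_m` frame, the congruence (c)). This file makes that explicit and repair-agnostic: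

* `twinWanFrameAtThreeMultTresT_of_thmB_of_allSplitMembersFrames_of_irredMemberRationalInclusion` (core) — ♭B′ BY NAME from Hsieh
  Thm B (PUBLISHED, by name), the CONSUMER-MINIMAL member/frame statement `C_min` SPELLED INLINE as a hypothesis (odd `p`; the Heegner
  residue binder `∃ β, 4N ∣ β² − d_K` REPLACED by the stricter `SatisfiesHeegnerHypothesis N K` = every prime of `N` splits in `K`;
  conclusion = the `R₀`-frame of `f` and, for every `m ≥ 1`, a member `D` with `Q_m` satisfying MF-compat ∧ `ρ̄_{g_m}` irreducible ∧
  Σ-frame ∧ (c) — NO rigidity-sign conjunct), and K1♯ = K1-at-3 CONFINED to `1 ≤ m` and residually irreducible members (the vet's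
  sharpening of child 27934: the line consumes K1 only there). The proof is p635340's, reading the member data through `C_min`.
* `twinWanFrameAtThreeMultTresT_of_thmB_of_allSplitMembersFrames_of_rationalInclusion` — the same with K1-at-3 VERBATIM (= child
  stmt-BirchSwinnertonDyer-27934 `TwinMemberRationalInclusionAtThree`), K1 ⟹ K1♯ being a projection.
* `allSplitMembersFrames_of_nonsplitMembersFrames` — the PRINT-FAITHFUL re-type `C′` BY NAME,
  `Castella2018.castella2020_thm211_members_frames_sigma_congruence_odd_nonsplit` (p643788, typer bsd-wall-utd-ty1 g12: p633915's text
  with hypothesis (iii) inserted after `Irr W p`, in the tree's erratum spelling `∀ q, Mult W q → (q non-split in K) → ¬ SplitMult W q`),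
  IMPLIES `C_min`: under `SatisfiesHeegnerHypothesis N K` every multiplicative `q` divides `N` (`dvd_conductorNorm_of_mult`) hence
  splits, so (iii) is vacuous, the Heegner residue is `exists_dvd_sq_sub_discr_holds`, and the rigidity conjunct is dropped.
* `twinWanFrameAtThreeMultTresT_of_thmB_of_nonsplitMembersFrames_of_rationalInclusion` — ♭B′ BY NAME from the two Literature facts
  Hsieh Thm B ∧ `…_odd_nonsplit` and K1-at-3 VERBATIM: the TURNKEY for the re-stated glue once the pen re-keys child 27933 to
  `…_odd_nonsplit` — «`TwinHsiehThmBInput → 27933R → TwinMemberRationalInclusionAtThree → TwinWanFrameAtThreeMultTresT`» :=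
  `fun hB hC hK ↦ twinWanFrameAtThreeMultTresT_of_thmB_of_nonsplitMembersFrames_of_rationalInclusion hB hC hK`;
  and `…_of_nonsplitMembersFrames_of_irredMemberRationalInclusion`, the same from K1♯ (closer-shape if 27934 is also sharpened).
  (Had the pen chosen one of the vet's consumer-minimal forms `C″` instead — β-binder ↦ `SatisfiesHeegnerHypothesis`, rigidity kept;
  or rigidity deleted, β kept — each implies `C_min` by a one-line projection / `exists_dvd_sq_sub_discr_holds`, and the core applies.)
CONDITIONAL exactly on {Hsieh Thm B (PUBLISHED), the member/frame input (PUBLISHED, Castella 2020 §2 Def. 2.10/Thm. 2.11 + Skinner 2016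
§2.6/§3.1, read at odd `p`: flag `MF-odd-p` of p633915), K1-at-3 (RESEARCH)}; no `def`, no `sorry`, no new fact; items closed 0; classes
closed 0; BSD is proved for no curve. References: [Hsieh2014] Thm. B; [Castella2020JIMJ] §2 Def. 2.10, Thm. 2.11; [Skinner2016PacificMC]
§2.6, §3.1; [Castella2018Erratum] Thm. 1.1 hyp. (iii) and proof (c); Castella, arXiv:2409.01360 Thm. 1.3 (iii) (the vet's locator).
-/

noncomputable section

open scoped Classical

set_option linter.dupNamespace false
set_option autoImplicit false

namespace Summit.BirchSwinnertonDyer.BirchSwinnertonDyer.Theorems.UniversalToricDescentTwinWanFrameAtThreeMultTresTAllSplit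

open PowerSeries WeierstrassCurve NumberField IsDedekindDomain Field
  Literature.NumberTheory.EllipticCurves
  Literature.NumberTheory.EllipticCurves.ModularForms
  Literature.NumberTheory.EllipticCurves.Rank1Residual
  Literature.NumberTheory.EllipticCurves.BigGaloisRep
  Literature.NumberTheory.EllipticCurves.GreenbergSelmer
  Literature.NumberTheory.GaloisRepresentations
  Summit.BirchSwinnertonDyer.Rank1Residual.X11b
  Summit.BirchSwinnertonDyer.Rank1Residual.X11b.Halves
  Summit.BirchSwinnertonDyer.BirchSwinnertonDyer.Theorems.SchneiderFree
  Summit.BirchSwinnertonDyer.BirchSwinnertonDyer.Theorems.UniversalToricDescentTwinTorsionRankOne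
  Summit.BirchSwinnertonDyer.BirchSwinnertonDyer.Theorems.UniversalToricDescentTwinDecLocus

set_option maxHeartbeats 800000 in
/-- **♭B′ `TwinWanFrameAtThreeMultTresT` BY NAME from Hsieh Thm B + the CONSUMER-MINIMAL odd-`p` member/frame statement over an
ALL-SPLIT `K` + K1♯-at-3 (K1 CONFINED to depth `m ≥ 1` and residually IRREDUCIBLE members)** — the glue of `membertower` v11 read
through `C_min` and through the vet's sharpening of K1. `hB` = `Hsieh2014.thmB_exists_isHsiehLFunction_coeff_norm_eq_one_unrPeriod_anyLevel`
(PUBLISHED); `hC` = `C_min` INLINE: for `E/ℚ` of conductor `N`, multiplicative at the odd `p`, `N/p ≥ 3`, `E[p]` irreducible, `K`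
imaginary quadratic with `d_K` odd and EVERY prime of `N` split (`SatisfiesHeegnerHypothesis N K`), `p` split, `𝔭` via `ι`, `κ`
anticyclotomic, receptacle maps `a`, `j`: an `R₀`-frame `(Ω_K, Ω_p, L)` of `f` and for every `m ≥ 1` a Hida member `D` with
`Q_m ∈ 𝓞_{ℂ_p}⟦T⟧`, `ι`-compatible, `ρ̄_{g_m}` irreducible, `Q_m` a Σ-imprimitive weight-`k_m` frame for the SAME periods, and (c)
`(Q_m) + (p^m) = (a(L·j(P_Σ))) + (p^m)` [Castella 2020 §2 Thm. 2.11 at odd `p`; Skinner 2016 §2.6/§3.1] — NO rigidity-sign clause;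
`hK1` = K1♯ = child 27934 `TwinMemberRationalInclusionAtThree` with the two extra binders `1 ≤ m →` and
`SkinnerUrban2014.IsResiduallyIrreducible D.Δ →` (VET-UTDR2-g0 «MUTATION / SHARPENING»: the line consumes K1 only at such members) —
a WEAKER research hypothesis than K1 verbatim. Proof = p635340 with the member data read through `C_min` (Heegner binder passed as `hH`;
clauses used: compat, irreducibility, Σ-frame, (c); `1 ≤ m` from the member-tower kernel).
[cite: Hsieh2014, Thm. B p. 712] [cite: Castella2020JIMJ, §2 Def. 2.10, Thm. 2.11] [cite: Skinner2016PacificMC, §2.6 (2-6-1), §3.1 (p. 192)]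
[cite: Serre1987, §2.9 Prop. 5] -/
theorem twinWanFrameAtThreeMultTresT_of_thmB_of_allSplitMembersFrames_of_irredMemberRationalInclusion
    (hB : Hsieh2014.thmB_exists_isHsiehLFunction_coeff_norm_eq_one_unrPeriod_anyLevel)
    (hC : ∀ {p : ℕ} [Fact p.Prime] (ι : PadicAlgCl p ≃+* ℂ) (W : WeierstrassCurve ℚ) [W.IsElliptic]
      [W.IsGloballyMinimal] (K : Type) [Field K] [NumberField K]
      (𝔭 : HeightOneSpectrum (𝓞 K)) (κ : ZpExtension K p) (γ : absoluteGaloisGroup K)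
      [Fact (κ.IsTopGenerator γ)] {N : ℕ} [NeZero N] {f : CuspForm (CongruenceSubgroup.Gamma0 N) 2}
      (_ : IsNewformOf W f),
      W.conductorNorm ℤ = N → p ≠ 2 → Mult W p → 3 ≤ N / p → Irr W p →
      IsImaginaryQuadratic K → Odd (NumberField.discr K) → SatisfiesHeegnerHypothesis N K →
      ((Ideal.span {(p : ℤ)}).primesOver (𝓞 K)).ncard = 2 →
      ((p : ℕ) : 𝓞 K) ∈ 𝔭.asIdeal →
      (∀ (w : InfinitePlace K) (x : 𝓞 K), x ∈ 𝔭.asIdeal ↔ ‖ι.symm (w.embedding (x : K))‖ < 1) →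
      κ.IsAnticyclotomic →
      ∀ (a : unrIntegers p →+* PadicComplexInt p) (j : ℤ_[p] →+* unrIntegers p),
        (∀ x : unrIntegers p, ((a x : PadicComplexInt p) : ℂ_[p]) = (x : ℂ_[p])) →
        (∀ x : ℤ_[p], ((j x : unrIntegers p) : ℂ_[p]) = algebraMap ℚ_[p] ℂ_[p] (x : ℚ_[p])) →
      ∃ (ΩK : ℂ) (Ωp : (unrIntegers p)ˣ) (L : UnrSeries p),
        ΩK ≠ 0 ∧ IsBDPLFunction ι 𝔭 κ γ f ΩK ((Ωp : unrIntegers p) : ℂ_[p]) L ∧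
        ∀ m : ℕ, 1 ≤ m →
          ∃ (D : Skinner2016.HidaCongruentMember W p m) (Qm : PowerSeries (PadicComplexInt p)),
            (∀ x : coeffField D.g, ι (D.ι x) = (x : ℂ)) ∧
            SkinnerUrban2014.IsResiduallyIrreducible D.Δ ∧
            IsBDPLFunctionWtSigmaInt ι 𝔭 κ γ D.g (W.sigmaPlacesFinset p K) ΩK ((Ωp : unrIntegers p) : ℂ_[p]) Qm ∧
            Ideal.span {Qm} ⊔ Ideal.span {(PowerSeries.C (((p : ℕ) : PadicComplexInt p) ^ m))} =
              Ideal.span {PowerSeries.map a (L * PowerSeries.map j (W.sigmaEulerElement p K κ))} ⊔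
                Ideal.span {(PowerSeries.C (((p : ℕ) : PadicComplexInt p) ^ m))})
    (hK1 :
      ∀ (W' : WeierstrassCurve ℚ) [W'.IsElliptic] [W'.IsGloballyMinimal] (N' : ℕ) [NeZero N']
        (K : Type) [Field K] [NumberField K] (Dt' : ModularParametrizationData W' N'),
        Mult W' 3 → W'.HasSurjectiveModNGaloisRep 3 → W'.conductorNorm ℤ = N' → IsImaginaryQuadratic K →
        SatisfiesHeegnerHypothesis N' K → Odd (NumberField.discr K) →
        ∀ (κ : ZpExtension K 3), κ.IsAnticyclotomic → ∀ (γ : absoluteGaloisGroup K) [Fact (κ.IsTopGenerator γ)]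
          (𝔭 : HeightOneSpectrum (𝓞 K)), ((3 : ℕ) : 𝓞 K) ∈ 𝔭.asIdeal →
          𝔭.asIdeal.ramificationIdx (𝓞 ℚ) = 1 → 𝔭.asIdeal.inertiaDeg (𝓞 ℚ) = 1 →
          ∀ (𝔭' : HeightOneSpectrum (𝓞 K)), ((3 : ℕ) : 𝓞 K) ∈ 𝔭'.asIdeal → 𝔭' ≠ 𝔭 →
          ∀ (ι' : PadicAlgCl 3 ≃+* ℂ), BranchInducesPrime 3 ι' 𝔭 →
          ∀ (m : ℕ), 1 ≤ m → ∀ (D : Skinner2016.HidaCongruentMember W' 3 m),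
            SkinnerUrban2014.IsResiduallyIrreducible D.Δ → (∀ x : coeffField D.g, ι' (D.ι x) = (x : ℂ)) →
          ∀ (b : padicCoeffIntegers D.ι →+* 𝓞_ℂ_[3]),
            (∀ x, ((b x : 𝓞_ℂ_[3]) : ℂ_[3]) = algebraMap (PadicAlgCl 3) ℂ_[3] (padicCoeffIntegers.toPadicAlgCl D.ι x)) →
          ∀ (ΩK : ℂ) (Ωp : (𝓞_ℂ_[3])ˣ) (Q : PowerSeries 𝓞_ℂ_[3]), ΩK ≠ 0 →
            IsBDPLFunctionWtSigmaInt ι' 𝔭 κ γ D.g (W'.sigmaPlacesFinset 3 K) ΩK ((Ωp : 𝓞_ℂ_[3]) : ℂ_[3]) Q →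
          ∀ [TopologicalSpace (PowerSeries (padicCoeffIntegers D.ι))]
            [ContinuousSMul (PowerSeries (padicCoeffIntegers D.ι))
              (BigRepModule (padicCoeffIntegers D.ι) 3 (Cofree D.Δ.ρ (padicCoeffField D.ι)))],
            Module.IsTorsion (PowerSeries (padicCoeffIntegers D.ι))
                (XBig κ (D.Δ.cofreeRepOver K) 𝔭' (↑(W'.sigmaPlacesFinset 3 K))) →
              ∃ e : ℕ, Ideal.span {(PowerSeries.C ((3 : ℕ) : 𝓞_ℂ_[3]) : PowerSeries 𝓞_ℂ_[3]) ^ e} *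
                  (XBig.charIdeal κ (D.Δ.cofreeRepOver K) 𝔭' (↑(W'.sigmaPlacesFinset 3 K))).map (PowerSeries.map b) ≤
                Ideal.span {Q}) :
    Summit.BirchSwinnertonDyer.BirchSwinnertonDyer.Theses.UniversalToricDescent.TwinWanFrameAtThreeMultTresT := by
  intro W' _ _ N' _ K _ _ Dt' hmult hsurj hN' hK hH hodd hndvd κ hκ γ _ 𝔭 h𝔭 he hf 𝔭' h𝔭' hne ι' hι'
  -- (dec) from the très-ramifié binder
  have hdec : ∀ Q : (W'.baseChange ℚ_[3]).toAffine.Point, 3 • Q = 0 → Q = 0 :=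
    twin_dec_of_forall_not_cube W' hmult (forall_not_exists_pow_of_nonsplit_or_not_dvd W' (Or.inr hndvd))
  -- the odd-`p` member/frame statement's binders from ♭B′'s
  have hirr : Irr W' 3 := hasIrreducibleModPGaloisRep_of_hasSurjectiveModNGaloisRep W' 3 hsurj
  have hM : 3 ≤ N' / 3 := by
    have h11 := Pasten2024.eleven_le_level Dt'
    omega
  have hsplit : ((Ideal.span {((3 : ℕ) : ℤ)}).primesOver (𝓞 K)).ncard = 2 :=
    ncard_primesOver_eq_two_of_degreeOne hK.1 h𝔭 he hf
  obtain ⟨ΩK, Ωp, L, hΩK, hL, hmem⟩ := hC ι' W' K 𝔭 κ γ Dt'.isNewformOf hN' (by decide) hmult hM hirr hK hodd hH hsplit h𝔭 hι'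
    hκ (R1.unrToCpInt 3) (toUnr 3) (R1.coe_unrToCpInt 3) (coe_toUnr 3)
  have hΩp' : (((Units.map (R1.unrToCpInt 3 : unrIntegers 3 →* 𝓞_ℂ_[3]) Ωp : (𝓞_ℂ_[3])ˣ) : 𝓞_ℂ_[3]) : ℂ_[3]) =
      ((Ωp : unrIntegers 3) : ℂ_[3]) := by
    rw [Units.coe_map, MonoidHom.coe_coe, R1.coe_unrToCpInt]
  have hΩp0 : ((Ωp : unrIntegers 3) : ℂ_[3]) ≠ 0 := fun h0 ↦
    Ωp.ne_zero ((ZeroMemClass.coe_eq_zero).mp h0)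
  -- `μ(L) = 0` from Thm B (♭-witness moved across periods, p538896)
  have hμL : ∃ i : ℕ, IsUnit (PowerSeries.coeff i L) := by
    obtain ⟨ΩK₁, Ωp₁, Q, hΩK₁, hΩp₁, hQ, hμQ⟩ :=
      Summit.BirchSwinnertonDyer.BirchSwinnertonDyer.Theorems.UniversalToricDescentSelfMuZero.self_exists_isBDPLFunctionInt_coeff_norm_eq_one
        hB W' N' K Dt' hsurj hK hH κ hκ γ 𝔭 h𝔭 he hf ι' hι'
    have hΩp₁0 : Ωp₁ ≠ 0 := fun h ↦ by rw [h, norm_zero] at hΩp₁; exact zero_ne_one hΩp₁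
    obtain ⟨i, hi⟩ :=
      Summit.BirchSwinnertonDyer.BirchSwinnertonDyer.Theorems.UniversalToricDescentFlatMuTransfer.exists_coeff_norm_eq_one_of_isBDPLFunctionInt_of_isBDPLFunction
        hK hκ Fact.out hΩK₁ hΩK hΩp₁0 hΩp0 hQ hL hμQ
    exact ⟨i, (unrIntegers.isUnit_iff_norm_eq_one _).mpr hi⟩
  refine ⟨ΩK, ((Ωp : unrIntegers 3) : ℂ_[3]), L, hΩK, hΩp0, hL, fun hT₀ ↦ ?_⟩
  refine twin_exists_forall_C_pow_mul_mem_span_of_cpIntMemberTower_of_isTorsion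
    SkinnerUrban2014.prop323_XAc_equiv_XBigDecomp_holds W' N' K hmult hsurj hN' hK hH κ hκ γ 𝔭' h𝔭' hdec hT₀ L hμL
    fun m hm ↦ ?_
  exact (hmem m hm).elim fun D hD ↦ hD.elim fun Qm hQ ↦
    ⟨D, Qm, fun b hb hT ↦ hK1 W' N' K Dt' hmult hsurj hN' hK hH hodd κ hκ γ 𝔭 h𝔭 he hf 𝔭' h𝔭' hne ι' hι' m hm D hQ.2.1 hQ.1 b hb
      ΩK (Units.map (R1.unrToCpInt 3 : unrIntegers 3 →* 𝓞_ℂ_[3]) Ωp) Qm hΩK (hΩp' ▸ hQ.2.2.1) hT, hQ.2.2.2⟩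

set_option maxHeartbeats 400000 in
/-- **♭B′ `TwinWanFrameAtThreeMultTresT` BY NAME from Hsieh Thm B + the consumer-minimal `C_min` (inline, as above) + K1-at-3 VERBATIM
(= child stmt-BirchSwinnertonDyer-27934 `TwinMemberRationalInclusionAtThree` = stub `stub_memberRationalInclusionAtThree` of
`membertower` v11).** Corollary of the K1♯ form (K1 ⟹ K1♯ by discarding the two extra binders). CONDITIONAL on {PUBLISHED, `C_min`
(PUBLISHED reading), K1-at-3 RESEARCH}; nothing is booked; BSD is proved for no curve.
[cite: Hsieh2014, Thm. B p. 712] [cite: Castella2020JIMJ, §2 Def. 2.10, Thm. 2.11] [cite: Skinner2016PacificMC, §2.6 (2-6-1), §3.1 (p. 192)] -/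
theorem twinWanFrameAtThreeMultTresT_of_thmB_of_allSplitMembersFrames_of_rationalInclusion
    (hB : Hsieh2014.thmB_exists_isHsiehLFunction_coeff_norm_eq_one_unrPeriod_anyLevel)
    (hC : ∀ {p : ℕ} [Fact p.Prime] (ι : PadicAlgCl p ≃+* ℂ) (W : WeierstrassCurve ℚ) [W.IsElliptic]
      [W.IsGloballyMinimal] (K : Type) [Field K] [NumberField K]
      (𝔭 : HeightOneSpectrum (𝓞 K)) (κ : ZpExtension K p) (γ : absoluteGaloisGroup K)
      [Fact (κ.IsTopGenerator γ)] {N : ℕ} [NeZero N] {f : CuspForm (CongruenceSubgroup.Gamma0 N) 2}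
      (_ : IsNewformOf W f),
      W.conductorNorm ℤ = N → p ≠ 2 → Mult W p → 3 ≤ N / p → Irr W p →
      IsImaginaryQuadratic K → Odd (NumberField.discr K) → SatisfiesHeegnerHypothesis N K →
      ((Ideal.span {(p : ℤ)}).primesOver (𝓞 K)).ncard = 2 →
      ((p : ℕ) : 𝓞 K) ∈ 𝔭.asIdeal →
      (∀ (w : InfinitePlace K) (x : 𝓞 K), x ∈ 𝔭.asIdeal ↔ ‖ι.symm (w.embedding (x : K))‖ < 1) →
      κ.IsAnticyclotomic →
      ∀ (a : unrIntegers p →+* PadicComplexInt p) (j : ℤ_[p] →+* unrIntegers p),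
        (∀ x : unrIntegers p, ((a x : PadicComplexInt p) : ℂ_[p]) = (x : ℂ_[p])) →
        (∀ x : ℤ_[p], ((j x : unrIntegers p) : ℂ_[p]) = algebraMap ℚ_[p] ℂ_[p] (x : ℚ_[p])) →
      ∃ (ΩK : ℂ) (Ωp : (unrIntegers p)ˣ) (L : UnrSeries p),
        ΩK ≠ 0 ∧ IsBDPLFunction ι 𝔭 κ γ f ΩK ((Ωp : unrIntegers p) : ℂ_[p]) L ∧
        ∀ m : ℕ, 1 ≤ m →
          ∃ (D : Skinner2016.HidaCongruentMember W p m) (Qm : PowerSeries (PadicComplexInt p)),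
            (∀ x : coeffField D.g, ι (D.ι x) = (x : ℂ)) ∧
            SkinnerUrban2014.IsResiduallyIrreducible D.Δ ∧
            IsBDPLFunctionWtSigmaInt ι 𝔭 κ γ D.g (W.sigmaPlacesFinset p K) ΩK ((Ωp : unrIntegers p) : ℂ_[p]) Qm ∧
            Ideal.span {Qm} ⊔ Ideal.span {(PowerSeries.C (((p : ℕ) : PadicComplexInt p) ^ m))} =
              Ideal.span {PowerSeries.map a (L * PowerSeries.map j (W.sigmaEulerElement p K κ))} ⊔
                Ideal.span {(PowerSeries.C (((p : ℕ) : PadicComplexInt p) ^ m))})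
    (hK1 :
      ∀ (W' : WeierstrassCurve ℚ) [W'.IsElliptic] [W'.IsGloballyMinimal] (N' : ℕ) [NeZero N']
        (K : Type) [Field K] [NumberField K] (Dt' : ModularParametrizationData W' N'),
        Mult W' 3 → W'.HasSurjectiveModNGaloisRep 3 → W'.conductorNorm ℤ = N' → IsImaginaryQuadratic K →
        SatisfiesHeegnerHypothesis N' K → Odd (NumberField.discr K) →
        ∀ (κ : ZpExtension K 3), κ.IsAnticyclotomic → ∀ (γ : absoluteGaloisGroup K) [Fact (κ.IsTopGenerator γ)]
          (𝔭 : HeightOneSpectrum (𝓞 K)), ((3 : ℕ) : 𝓞 K) ∈ 𝔭.asIdeal →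
          𝔭.asIdeal.ramificationIdx (𝓞 ℚ) = 1 → 𝔭.asIdeal.inertiaDeg (𝓞 ℚ) = 1 →
          ∀ (𝔭' : HeightOneSpectrum (𝓞 K)), ((3 : ℕ) : 𝓞 K) ∈ 𝔭'.asIdeal → 𝔭' ≠ 𝔭 →
          ∀ (ι' : PadicAlgCl 3 ≃+* ℂ), BranchInducesPrime 3 ι' 𝔭 →
          ∀ (m : ℕ) (D : Skinner2016.HidaCongruentMember W' 3 m), (∀ x : coeffField D.g, ι' (D.ι x) = (x : ℂ)) →
          ∀ (b : padicCoeffIntegers D.ι →+* 𝓞_ℂ_[3]),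
            (∀ x, ((b x : 𝓞_ℂ_[3]) : ℂ_[3]) = algebraMap (PadicAlgCl 3) ℂ_[3] (padicCoeffIntegers.toPadicAlgCl D.ι x)) →
          ∀ (ΩK : ℂ) (Ωp : (𝓞_ℂ_[3])ˣ) (Q : PowerSeries 𝓞_ℂ_[3]), ΩK ≠ 0 →
            IsBDPLFunctionWtSigmaInt ι' 𝔭 κ γ D.g (W'.sigmaPlacesFinset 3 K) ΩK ((Ωp : 𝓞_ℂ_[3]) : ℂ_[3]) Q →
          ∀ [TopologicalSpace (PowerSeries (padicCoeffIntegers D.ι))]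
            [ContinuousSMul (PowerSeries (padicCoeffIntegers D.ι))
              (BigRepModule (padicCoeffIntegers D.ι) 3 (Cofree D.Δ.ρ (padicCoeffField D.ι)))],
            Module.IsTorsion (PowerSeries (padicCoeffIntegers D.ι))
                (XBig κ (D.Δ.cofreeRepOver K) 𝔭' (↑(W'.sigmaPlacesFinset 3 K))) →
              ∃ e : ℕ, Ideal.span {(PowerSeries.C ((3 : ℕ) : 𝓞_ℂ_[3]) : PowerSeries 𝓞_ℂ_[3]) ^ e} *
                  (XBig.charIdeal κ (D.Δ.cofreeRepOver K) 𝔭' (↑(W'.sigmaPlacesFinset 3 K))).map (PowerSeries.map b) ≤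
                Ideal.span {Q}) :
    Summit.BirchSwinnertonDyer.BirchSwinnertonDyer.Theses.UniversalToricDescent.TwinWanFrameAtThreeMultTresT :=
  twinWanFrameAtThreeMultTresT_of_thmB_of_allSplitMembersFrames_of_irredMemberRationalInclusion hB hC
    fun W' _ _ N' _ K _ _ Dt' hmult hsurj hN' hK hH hodd κ hκ γ _ 𝔭 h𝔭 he hf 𝔭' h𝔭' hne ι' hι' m _ D _ ↦
      hK1 W' N' K Dt' hmult hsurj hN' hK hH hodd κ hκ γ 𝔭 h𝔭 he hf 𝔭' h𝔭' hne ι' hι' m D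

/-- **The PRINT-FAITHFUL re-type `Castella2018.castella2020_thm211_members_frames_sigma_congruence_odd_nonsplit` (p643788) of the odd-`p`
member/frame fact IMPLIES the consumer-minimal `C_min` over an all-split `K`.** The re-type is p633915's text with Castella's hypothesis
(iii) «`E` has non-split multiplicative reduction at each `q ∥ N` non-split in `K`» inserted after `Irr W p` (tree spelling
`∀ q, Mult W q → (primesOver q).ncard ≠ 2 → ¬ SplitMult W q`). Under `SatisfiesHeegnerHypothesis N K` a multiplicative
`q` divides `N` (`dvd_conductorNorm_of_mult`) hence splits in `K`, so (iii) is vacuous; the Heegner residue `∃ β, 4N ∣ β² − d_K` is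
`exists_dvd_sq_sub_discr_holds`; the rigidity-sign conjunct of the conclusion is discarded. Bookkeeping, proved.
[cite: Castella2018Erratum, Thm. 1.1 hyp. (iii) and proof (c) (p. 4)] [cite: Castella2020JIMJ, §2 Thm. 2.11] [cite: Gross1984, §3] -/
theorem allSplitMembersFrames_of_nonsplitMembersFrames
    (hC' : Castella2018.castella2020_thm211_members_frames_sigma_congruence_odd_nonsplit) :
    ∀ {p : ℕ} [Fact p.Prime] (ι : PadicAlgCl p ≃+* ℂ) (W : WeierstrassCurve ℚ) [W.IsElliptic]
      [W.IsGloballyMinimal] (K : Type) [Field K] [NumberField K]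
      (𝔭 : HeightOneSpectrum (𝓞 K)) (κ : ZpExtension K p) (γ : absoluteGaloisGroup K)
      [Fact (κ.IsTopGenerator γ)] {N : ℕ} [NeZero N] {f : CuspForm (CongruenceSubgroup.Gamma0 N) 2}
      (_ : IsNewformOf W f),
      W.conductorNorm ℤ = N → p ≠ 2 → Mult W p → 3 ≤ N / p → Irr W p →
      IsImaginaryQuadratic K → Odd (NumberField.discr K) → SatisfiesHeegnerHypothesis N K →
      ((Ideal.span {(p : ℤ)}).primesOver (𝓞 K)).ncard = 2 →
      ((p : ℕ) : 𝓞 K) ∈ 𝔭.asIdeal →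
      (∀ (w : InfinitePlace K) (x : 𝓞 K), x ∈ 𝔭.asIdeal ↔ ‖ι.symm (w.embedding (x : K))‖ < 1) →
      κ.IsAnticyclotomic →
      ∀ (a : unrIntegers p →+* PadicComplexInt p) (j : ℤ_[p] →+* unrIntegers p),
        (∀ x : unrIntegers p, ((a x : PadicComplexInt p) : ℂ_[p]) = (x : ℂ_[p])) →
        (∀ x : ℤ_[p], ((j x : unrIntegers p) : ℂ_[p]) = algebraMap ℚ_[p] ℂ_[p] (x : ℚ_[p])) →
      ∃ (ΩK : ℂ) (Ωp : (unrIntegers p)ˣ) (L : UnrSeries p),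
        ΩK ≠ 0 ∧ IsBDPLFunction ι 𝔭 κ γ f ΩK ((Ωp : unrIntegers p) : ℂ_[p]) L ∧
        ∀ m : ℕ, 1 ≤ m →
          ∃ (D : Skinner2016.HidaCongruentMember W p m) (Qm : PowerSeries (PadicComplexInt p)),
            (∀ x : coeffField D.g, ι (D.ι x) = (x : ℂ)) ∧
            SkinnerUrban2014.IsResiduallyIrreducible D.Δ ∧
            IsBDPLFunctionWtSigmaInt ι 𝔭 κ γ D.g (W.sigmaPlacesFinset p K) ΩK ((Ωp : unrIntegers p) : ℂ_[p]) Qm ∧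
            Ideal.span {Qm} ⊔ Ideal.span {(PowerSeries.C (((p : ℕ) : PadicComplexInt p) ^ m))} =
              Ideal.span {PowerSeries.map a (L * PowerSeries.map j (W.sigmaEulerElement p K κ))} ⊔
                Ideal.span {(PowerSeries.C (((p : ℕ) : PadicComplexInt p) ^ m))} := by
  intro p _ ι W _ _ K _ _ 𝔭 κ γ _ N _ f hf hN hp hmult hM hirr hK hodd hH hsplit h𝔭 hι hκ a j ha hj
  -- print (iii) is vacuous over an all-split `K`: a multiplicative `q` divides `N`, hence splits
  have hiii : ∀ (q : ℕ) [Fact q.Prime], Mult W q → ((Ideal.span {(q : ℤ)}).primesOver (𝓞 K)).ncard ≠ 2 →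
      ¬ W.HasSplitMultiplicativeReductionAtPrime q :=
    fun q _ hq hns _ ↦ hns (hH q Fact.out (hN ▸ dvd_conductorNorm_of_mult hq))
  -- the Heegner residue from the (strict) Heegner hypothesis
  have hβ : ∃ β : ℤ, (4 * N : ℤ) ∣ β ^ 2 - NumberField.discr K := exists_dvd_sq_sub_discr_holds N K hK hH
  obtain ⟨ΩK, Ωp, L, hΩK, hL, hmem⟩ := hC' ι W K 𝔭 κ γ hf hN hp hmult hM hirr hiii hK hodd hβ hsplit h𝔭 hι hκ a j ha hj
  exact ⟨ΩK, Ωp, L, hΩK, hL, fun m hm ↦ (hmem m hm).elim fun D hD ↦ hD.elim fun Qm hQ ↦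
    ⟨D, Qm, hQ.1, hQ.2.1, hQ.2.2.2.1, hQ.2.2.2.2⟩⟩

set_option maxHeartbeats 400000 in
/-- **♭B′ `TwinWanFrameAtThreeMultTresT` BY NAME from the two Literature facts — Hsieh Thm B
(`Hsieh2014.thmB_exists_isHsiehLFunction_coeff_norm_eq_one_unrPeriod_anyLevel`) and the PRINT-FAITHFUL re-type
`Castella2018.castella2020_thm211_members_frames_sigma_congruence_odd_nonsplit` (p643788; hypothesis (iii) «non-split multiplicative at
every `q ∥ N` non-split in `K`» added) — and K1-at-3 VERBATIM (child stmt-BirchSwinnertonDyer-27934)**: the composition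
`…_of_allSplitMembersFrames_of_rationalInclusion hB (allSplitMembersFrames_of_nonsplitMembersFrames hC′) hK1`. TURNKEY for the
member-tower glue once child 27933 is re-keyed to `…_odd_nonsplit`: the glue «Hsieh-input → 27933R → 27934 → ♭B′» is
`fun hB hC hK ↦ twinWanFrameAtThreeMultTresT_of_thmB_of_nonsplitMembersFrames_of_rationalInclusion hB hC hK`. CONDITIONAL on {PUBLISHED,
PUBLISHED, K1-at-3 RESEARCH}; nothing is booked; BSD is proved for no curve.
[cite: Hsieh2014, Thm. B p. 712] [cite: Castella2020JIMJ, §2 Def. 2.10, Thm. 2.11] [cite: Castella2018Erratum, Thm. 1.1 hyp. (iii), proof (c) (p. 4)]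
[cite: Skinner2016PacificMC, §2.6 (2-6-1), §3.1 (p. 192)] -/
theorem twinWanFrameAtThreeMultTresT_of_thmB_of_nonsplitMembersFrames_of_rationalInclusion
    (hB : Hsieh2014.thmB_exists_isHsiehLFunction_coeff_norm_eq_one_unrPeriod_anyLevel)
    (hC' : Castella2018.castella2020_thm211_members_frames_sigma_congruence_odd_nonsplit)
    (hK1 :
      ∀ (W' : WeierstrassCurve ℚ) [W'.IsElliptic] [W'.IsGloballyMinimal] (N' : ℕ) [NeZero N']
        (K : Type) [Field K] [NumberField K] (Dt' : ModularParametrizationData W' N'),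
        Mult W' 3 → W'.HasSurjectiveModNGaloisRep 3 → W'.conductorNorm ℤ = N' → IsImaginaryQuadratic K →
        SatisfiesHeegnerHypothesis N' K → Odd (NumberField.discr K) →
        ∀ (κ : ZpExtension K 3), κ.IsAnticyclotomic → ∀ (γ : absoluteGaloisGroup K) [Fact (κ.IsTopGenerator γ)]
          (𝔭 : HeightOneSpectrum (𝓞 K)), ((3 : ℕ) : 𝓞 K) ∈ 𝔭.asIdeal →
          𝔭.asIdeal.ramificationIdx (𝓞 ℚ) = 1 → 𝔭.asIdeal.inertiaDeg (𝓞 ℚ) = 1 →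
          ∀ (𝔭' : HeightOneSpectrum (𝓞 K)), ((3 : ℕ) : 𝓞 K) ∈ 𝔭'.asIdeal → 𝔭' ≠ 𝔭 →
          ∀ (ι' : PadicAlgCl 3 ≃+* ℂ), BranchInducesPrime 3 ι' 𝔭 →
          ∀ (m : ℕ) (D : Skinner2016.HidaCongruentMember W' 3 m), (∀ x : coeffField D.g, ι' (D.ι x) = (x : ℂ)) →
          ∀ (b : padicCoeffIntegers D.ι →+* 𝓞_ℂ_[3]),
            (∀ x, ((b x : 𝓞_ℂ_[3]) : ℂ_[3]) = algebraMap (PadicAlgCl 3) ℂ_[3] (padicCoeffIntegers.toPadicAlgCl D.ι x)) →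
          ∀ (ΩK : ℂ) (Ωp : (𝓞_ℂ_[3])ˣ) (Q : PowerSeries 𝓞_ℂ_[3]), ΩK ≠ 0 →
            IsBDPLFunctionWtSigmaInt ι' 𝔭 κ γ D.g (W'.sigmaPlacesFinset 3 K) ΩK ((Ωp : 𝓞_ℂ_[3]) : ℂ_[3]) Q →
          ∀ [TopologicalSpace (PowerSeries (padicCoeffIntegers D.ι))]
            [ContinuousSMul (PowerSeries (padicCoeffIntegers D.ι))
              (BigRepModule (padicCoeffIntegers D.ι) 3 (Cofree D.Δ.ρ (padicCoeffField D.ι)))],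
            Module.IsTorsion (PowerSeries (padicCoeffIntegers D.ι))
                (XBig κ (D.Δ.cofreeRepOver K) 𝔭' (↑(W'.sigmaPlacesFinset 3 K))) →
              ∃ e : ℕ, Ideal.span {(PowerSeries.C ((3 : ℕ) : 𝓞_ℂ_[3]) : PowerSeries 𝓞_ℂ_[3]) ^ e} *
                  (XBig.charIdeal κ (D.Δ.cofreeRepOver K) 𝔭' (↑(W'.sigmaPlacesFinset 3 K))).map (PowerSeries.map b) ≤
                Ideal.span {Q}) :
    Summit.BirchSwinnertonDyer.BirchSwinnertonDyer.Theses.UniversalToricDescent.TwinWanFrameAtThreeMultTresT :=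
  twinWanFrameAtThreeMultTresT_of_thmB_of_allSplitMembersFrames_of_rationalInclusion hB
    (allSplitMembersFrames_of_nonsplitMembersFrames hC') hK1

set_option maxHeartbeats 400000 in
/-- **♭B′ `TwinWanFrameAtThreeMultTresT` BY NAME from the two Literature facts (Hsieh Thm B, `…_odd_nonsplit`) and K1♯-at-3** (K1 confined
to depth `m ≥ 1` and residually irreducible members — the vet's sharpening): the closer-shape if the pen ALSO re-types child 27934 with
the binders `1 ≤ m →` / `SkinnerUrban2014.IsResiduallyIrreducible D.Δ →`. CONDITIONAL on {PUBLISHED, PUBLISHED, K1♯ RESEARCH}; nothing is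
booked; BSD is proved for no curve.
[cite: Hsieh2014, Thm. B p. 712] [cite: Castella2020JIMJ, §2 Def. 2.10, Thm. 2.11] [cite: Castella2018Erratum, Thm. 1.1 hyp. (iii), proof (c) (p. 4)] -/
theorem twinWanFrameAtThreeMultTresT_of_thmB_of_nonsplitMembersFrames_of_irredMemberRationalInclusion
    (hB : Hsieh2014.thmB_exists_isHsiehLFunction_coeff_norm_eq_one_unrPeriod_anyLevel)
    (hC' : Castella2018.castella2020_thm211_members_frames_sigma_congruence_odd_nonsplit)
    (hK1 :
      ∀ (W' : WeierstrassCurve ℚ) [W'.IsElliptic] [W'.IsGloballyMinimal] (N' : ℕ) [NeZero N']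
        (K : Type) [Field K] [NumberField K] (Dt' : ModularParametrizationData W' N'),
        Mult W' 3 → W'.HasSurjectiveModNGaloisRep 3 → W'.conductorNorm ℤ = N' → IsImaginaryQuadratic K →
        SatisfiesHeegnerHypothesis N' K → Odd (NumberField.discr K) →
        ∀ (κ : ZpExtension K 3), κ.IsAnticyclotomic → ∀ (γ : absoluteGaloisGroup K) [Fact (κ.IsTopGenerator γ)]
          (𝔭 : HeightOneSpectrum (𝓞 K)), ((3 : ℕ) : 𝓞 K) ∈ 𝔭.asIdeal →
          𝔭.asIdeal.ramificationIdx (𝓞 ℚ) = 1 → 𝔭.asIdeal.inertiaDeg (𝓞 ℚ) = 1 →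
          ∀ (𝔭' : HeightOneSpectrum (𝓞 K)), ((3 : ℕ) : 𝓞 K) ∈ 𝔭'.asIdeal → 𝔭' ≠ 𝔭 →
          ∀ (ι' : PadicAlgCl 3 ≃+* ℂ), BranchInducesPrime 3 ι' 𝔭 →
          ∀ (m : ℕ), 1 ≤ m → ∀ (D : Skinner2016.HidaCongruentMember W' 3 m),
            SkinnerUrban2014.IsResiduallyIrreducible D.Δ → (∀ x : coeffField D.g, ι' (D.ι x) = (x : ℂ)) →
          ∀ (b : padicCoeffIntegers D.ι →+* 𝓞_ℂ_[3]),
            (∀ x, ((b x : 𝓞_ℂ_[3]) : ℂ_[3]) = algebraMap (PadicAlgCl 3) ℂ_[3] (padicCoeffIntegers.toPadicAlgCl D.ι x)) →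
          ∀ (ΩK : ℂ) (Ωp : (𝓞_ℂ_[3])ˣ) (Q : PowerSeries 𝓞_ℂ_[3]), ΩK ≠ 0 →
            IsBDPLFunctionWtSigmaInt ι' 𝔭 κ γ D.g (W'.sigmaPlacesFinset 3 K) ΩK ((Ωp : 𝓞_ℂ_[3]) : ℂ_[3]) Q →
          ∀ [TopologicalSpace (PowerSeries (padicCoeffIntegers D.ι))]
            [ContinuousSMul (PowerSeries (padicCoeffIntegers D.ι))
              (BigRepModule (padicCoeffIntegers D.ι) 3 (Cofree D.Δ.ρ (padicCoeffField D.ι)))],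
            Module.IsTorsion (PowerSeries (padicCoeffIntegers D.ι))
                (XBig κ (D.Δ.cofreeRepOver K) 𝔭' (↑(W'.sigmaPlacesFinset 3 K))) →
              ∃ e : ℕ, Ideal.span {(PowerSeries.C ((3 : ℕ) : 𝓞_ℂ_[3]) : PowerSeries 𝓞_ℂ_[3]) ^ e} *
                  (XBig.charIdeal κ (D.Δ.cofreeRepOver K) 𝔭' (↑(W'.sigmaPlacesFinset 3 K))).map (PowerSeries.map b) ≤
                Ideal.span {Q}) :
    Summit.BirchSwinnertonDyer.BirchSwinnertonDyer.Theses.UniversalToricDescent.TwinWanFrameAtThreeMultTresT :=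
  twinWanFrameAtThreeMultTresT_of_thmB_of_allSplitMembersFrames_of_irredMemberRationalInclusion hB
    (allSplitMembersFrames_of_nonsplitMembersFrames hC') hK1

end Summit.BirchSwinnertonDyer.BirchSwinnertonDyer.Theorems.UniversalToricDescentTwinWanFrameAtThreeMultTresTAllSplit

end
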